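import Summits.BirchSwinnertonDyer.BirchSwinnertonDyer.Theorems.GenusKolyvaginAtTwoMinimalTwinBSDTwoSwappedPairSandwich
import HarnessLib

/-!
# Route `GenusKolyvaginAtTwo`, crux U₂ `MinimalTwinBSDTwo` (stmt-BirchSwinnertonDyer-22985): THE SWAPPED PAIR SANDWICH WITHOUT THE
# ODD-TAMAGAWA HYPOTHESIS — `Ш(E/K)[2^∞] = 0` on `Δ < 0` whenever the twin costs AT MOST ONE MORE BIT than the curve
# (`ord₂ C(Wd) ≤ ord₂ C(W) + 1`), in particular on the cell `(Δ < 0, ord₂ C(W) = 1)` that the route actually consumes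

Seat `bsd-line-gk2-p3` g28 (PROVER seat 3/3, cell `bsd-f1-sign2`), `--supports stmt-BirchSwinnertonDyer-22985` (helper; closes nothing).
THEOREMS ONLY (no definition, no named fact, no `sorry`); standard axioms.  **BSD is NOT proved by this file; U₂ / hTw is NOT proved;
no item is closed.**  Everything here is UNCONDITIONAL (no print fact, no Kolyvagin prime, no Q2).

WHY (sequel of gk2-p2 g23's `…SwappedPairSandwich`, p764716, and of this seat's `…TamagawaSlices`, p766209).  The route's deciding theorem
consumes U₂ on two Tamagawa cells only: `hTw0 = (Δ > 0, ord₂ C = 0)` — LINE 23's odd-Tamagawa slice — and `hTw1 = (Δ < 0, ord₂ C = 1)`, which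
LINE 23 v1.2 declares residual (S4) because every budget lemma of the pair sandwich (gk2-p3 g17/g18/g27, gk2-p5 g34, g23) carries the binder
`Odd C(W)`.  That binder is NOT structural: it enters ONLY through gk2-p3 g17's conversion
`prod_ncard_roots_add_one_eq_two_pow_padicValNat_tamagawaProduct_twin` (`∏_{q∣d_K} (1 + #roots_q) = 2^{ord₂ C(Wd)}` when `C(W)` is odd) of the
genus budget into Tamagawa currency.  The hT-free conversion is the tree's `padicValNat_two_tamagawaProduct_twin_eq`
(`ord₂ C(Wd) = ord₂ C(W) + Σ_q ord₂(1 + #roots_q)`), so: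

* §1 `prod_ncard_roots_add_one_mul_eq_two_pow_padicValNat_tamagawaProduct_twin` — **`(∏_{q∣d_K} (1 + #roots_q)) · 2^{ord₂ C(W)} =
  2^{ord₂ C(Wd)}`** for ANY globally minimal `W` (no parity hypothesis); `prod_ncard_roots_add_one_le_two_of_le_succ` — the genus budget
  is `≤ 2` (at most one transposition prime of `d_K`, the rest silent) iff **`ord₂ C(Wd) ≤ ord₂ C(W) + 1`**.
* §2 **`finite_and_natCard_primaryComponent_sha_baseChange_two_eq_one_of_swappedPair_of_le_succ`** — g23's swapped pair sandwich RE-RUN with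
  the budget of §1: `W/ℚ` globally minimal, **`Δ_W < 0`, any `C(W)`**; `K` imaginary quadratic, `d_K` odd, Heegner for `N_W`; `E(K)[2] = 0`;
  `rank E(ℚ) ≥ 1`, `#Sel₂(E) = 2`; `Wd = Cd • W^(d_K)` elliptic with `#Sel₂(Wd) = 1` and **`ord₂ C(Wd) ≤ ord₂ C(W) + 1`**: then
  **`#Ш(E/K)[2^∞] = 1`** (finite).  Proof = g23's proof verbatim (base `T₀ = W^(d_K)` of rank `0` with `Ш(T₀/ℚ)[2^∞] = 0`, its twist
  `T₀^(d_K) = D • W` the rank-one member with `Ш[2^∞] = 0`, frame point = twist of a rational point of infinite order, gk2-p3 g27's sign-free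
  `natCard_sha_dvd_pow_of_pair_of_frame`, twist transport `Ψ`), with BOTH relaxed indices bounded by the model-free core
  `relIndex_sha_relaxed_le_prod_natCard_twoTorsion` (`≤ ∏_{q∣d_K} #X(ℚ_q)[2] = ∏ (1 + #roots_q) ≤ 2`; on `Δ < 0` the real condition is
  automatic).  `…_of_le_succ'`: the same with `E(K)[2] = 0` discharged from `#Sel₂(E) = 2` (g23's `forall_two_zsmul_baseChange_eq_zero_of_heegner`).
  On `C(W)` odd this is g23's `Δ < 0` branch; on **`ord₂ C(W) = 1`** (the cell `hTw1`) it is NEW: with a `2`-Selmer-trivial twin by a field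
  whose discriminant has one transposition prime (e.g. `|d_K|` prime on `Δ < 0`, `ord₂ C(Wd) = 2`), `Ш(E/K)[2^∞] = 0` unconditionally.

CONSEQUENCE (census, for the planner-of-record and LINE 23's pen): on `hTw1` Gross–Zagier over `K` reads `ord₂ #Ш_an(E_K) = 2 ord₂[E(K):ℤy_K]
− 2 ord₂ C(E) − 2 ord₂ c` (`C(E/K) = C(E)²`: the ramified prime is good), so with §2 BSD predicts `ord₂ [E(K):ℤy_K] = 1` there — the reversed
supply for `hTw1` must carry the DEPTH-ONE clause «`2 ∣ y_K`, `4 ∤ y_K`» instead of LINE 23's `2`-primitivity (sequel file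
`…SwappedPairOneBitDescent`: the `ε = −1` descent at `M₀ = 1` and its losslessness).  Beyond print: no (Kramer 1981 / Gross 1991 §5 descent
algebra, re-assembled).  BSD is NOT proved; nothing is closed.

References: [Kramer1981] Thm. 1, §2 Prop. 3; [GrossLMS1991] §5 (5.1)–(5.3); [BoxerDiao2010] proof of Prop. 4.1; [SilvermanAEC2009] X.4.2,
X.5 Cor. 5.4, Exercise 10.16; [MilneADT2006] I Rem. 3.7, Thm. 6.13.
-/

set_option autoImplicit false
set_option linter.dupNamespace false -- `Summit.<P>.<Sub>` repeats `BirchSwinnertonDyer` (D-0017)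

noncomputable section

open scoped Classical

namespace Summit.BirchSwinnertonDyer.BirchSwinnertonDyer.Theorems.GenusExact.TwinSwap.OneBit

open Literature.NumberTheory.EllipticCurves Literature.NumberTheory.GaloisRepresentations WeierstrassCurve NumberField
  IsDedekindDomain Field AddSubgroup
open Summit.BirchSwinnertonDyer.Rank1Residual Literature.Barriers.BirchSwinnertonDyer
open Summit.BirchSwinnertonDyer.BirchSwinnertonDyer.Theorems.GenusExact.PlusDescent
open Summit.BirchSwinnertonDyer.BirchSwinnertonDyer.Theorems.GenusExact.TwinSwap

/-! ## §1 The genus budget in Tamagawa currency WITHOUT the odd-Tamagawa hypothesis -/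

section Budget

variable (W : WeierstrassCurve ℚ) [W.IsElliptic] [W.IsGloballyMinimal]
  {K : Type} [Field K] [NumberField K]

/-- **`(∏_{q ∣ d_K} (#{roots of ψ mod q} + 1)) · 2^{ord₂ C(W)} = 2^{ord₂ C(Wd)}`** for `W/ℚ` globally minimal (ANY Tamagawa product), `K`
imaginary quadratic with odd `d_K` satisfying the Heegner hypothesis for `N_W`, `Wd = Cd • W^(d_K)` any elliptic model of the twist.  The
tree's hT-free `padicValNat_two_tamagawaProduct_twin_eq` (`ord₂ C(Wd) = ord₂ C(W) + Σ_q ord₂(1 + #roots_q)`) and `one_add_card_roots_eq_two_pow`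
(each `1 + #roots_q = #W̃(𝔽_q)[2]` is a power of `2`).  Generalises gk2-p3 g17's `prod_ncard_roots_add_one_eq_two_pow_padicValNat_tamagawaProduct_twin`
(the case `C(W)` odd).  [cite: Kramer1981, §2 Prop. 3] [cite: BoxerDiao2010, proof of Prop. 4.1 (p. 1977)] -/
theorem prod_ncard_roots_add_one_mul_eq_two_pow_padicValNat_tamagawaProduct_twin (hK : IsImaginaryQuadratic K)
    (hodd : Odd (NumberField.discr K)) (hH : SatisfiesHeegnerHypothesis (W.conductorNorm ℤ) K)
    {Wd : WeierstrassCurve ℚ} [Wd.IsElliptic] (Cd : VariableChange ℚ) (hWd : Cd • W.quadraticTwist (NumberField.discr K : ℚ) = Wd) :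
    (∏ q ∈ (NumberField.discr K).natAbs.primeFactors,
        ({x : ZMod q | 4 * x ^ 3 + ((integralModelInt W).b₂ : ZMod q) * x ^ 2 +
          2 * ((integralModelInt W).b₄ : ZMod q) * x + ((integralModelInt W).b₆ : ZMod q) = 0}.ncard + 1)) *
        2 ^ padicValNat 2 W.tamagawaProduct =
      2 ^ padicValNat 2 Wd.tamagawaProduct := by
  rw [padicValNat_two_tamagawaProduct_twin_eq W hK hodd hH Cd hWd, pow_add, ← Finset.prod_pow_eq_pow_sum, mul_comm]
  congr 1
  refine Finset.prod_congr rfl fun q hq ↦ ?_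
  obtain ⟨hqP, hqdvd, -⟩ := Nat.mem_primeFactors.mp hq
  have hqd : (q : ℤ) ∣ NumberField.discr K := Int.natCast_dvd.mpr hqdvd
  haveI := Fact.mk hqP
  have hq2 : q ≠ 2 := by
    rintro rfl
    exact (Int.not_even_iff_odd.mpr hodd) (even_iff_two_dvd.mpr (by exact_mod_cast hqd))
  have hqΔ : ¬ (q : ℤ) ∣ minimalDiscriminantInt W :=
    not_dvd_minimalDiscriminantInt_of_dvd_discr_of_heegner W K hK.1 hH hqP hq2 hqd
  rw [Set.ncard_eq_toFinset_card', Set.toFinset_setOf, add_comm]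
  exact one_add_card_roots_eq_two_pow W hq2 hqΔ

/-- **The genus budget is at most one bit iff `ord₂ C(Wd) ≤ ord₂ C(W) + 1`**: then `∏_{q ∣ d_K} (#roots_q + 1) ≤ 2` (at most one prime of
`d_K` is a transposition prime and none is an identity prime).  No parity hypothesis on `C(W)`. [cite: Kramer1981, §2 Prop. 3] -/
theorem prod_ncard_roots_add_one_le_two_of_le_succ (hK : IsImaginaryQuadratic K)
    (hodd : Odd (NumberField.discr K)) (hH : SatisfiesHeegnerHypothesis (W.conductorNorm ℤ) K)
    {Wd : WeierstrassCurve ℚ} [Wd.IsElliptic] (Cd : VariableChange ℚ) (hWd : Cd • W.quadraticTwist (NumberField.discr K : ℚ) = Wd)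
    (hDEF : padicValNat 2 Wd.tamagawaProduct ≤ padicValNat 2 W.tamagawaProduct + 1) :
    ∏ q ∈ (NumberField.discr K).natAbs.primeFactors,
        ({x : ZMod q | 4 * x ^ 3 + ((integralModelInt W).b₂ : ZMod q) * x ^ 2 +
          2 * ((integralModelInt W).b₄ : ZMod q) * x + ((integralModelInt W).b₆ : ZMod q) = 0}.ncard + 1) ≤ 2 := by
  have h := prod_ncard_roots_add_one_mul_eq_two_pow_padicValNat_tamagawaProduct_twin W hK hodd hH Cd hWd
  have hle : 2 ^ padicValNat 2 Wd.tamagawaProduct ≤ 2 * 2 ^ padicValNat 2 W.tamagawaProduct := by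
    calc 2 ^ padicValNat 2 Wd.tamagawaProduct ≤ 2 ^ (padicValNat 2 W.tamagawaProduct + 1) := Nat.pow_le_pow_right (by norm_num) hDEF
      _ = 2 * 2 ^ padicValNat 2 W.tamagawaProduct := by rw [pow_succ, mul_comm]
  rw [← h] at hle
  exact Nat.le_of_mul_le_mul_right hle (Nat.pos_of_ne_zero (pow_ne_zero _ two_ne_zero))

end Budget

/-! ## §2 The swapped pair sandwich on `Δ < 0` with the one-bit budget (no parity hypothesis on `C(W)`) -/

section Swapped

variable (W : WeierstrassCurve ℚ) [W.IsElliptic] [W.IsGloballyMinimal]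
variable (K : Type) [Field K] [NumberField K]

/-- **THE SWAPPED PAIR SANDWICH WITHOUT `Odd C(W)`.**  `W/ℚ` globally minimal with `Δ_W < 0` (any Tamagawa product); `K` imaginary quadratic,
`d_K` odd, Heegner for `N_W`; `E(K)[2] = 0`; `rank E(ℚ) ≥ 1` and `#Sel₂(E/ℚ) = 2`; `Wd = Cd • W^(d_K)` elliptic with `#Sel₂(Wd/ℚ) = 1` and the
ONE-BIT budget **`ord₂ C(Wd) ≤ ord₂ C(W) + 1`**.  Then `Ш(E/K)[2^∞]` is finite and **`#Ш(E/K)[2^∞] = 1`**.  Proof = gk2-p2 g23's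
`finite_and_natCard_primaryComponent_sha_baseChange_two_eq_one_of_swappedPair` (p764716) verbatim — base `T₀ = W^(d_K)` (rank `0`,
`Ш(T₀/ℚ)[2^∞] = 0`, `ℚ`-side exponent `0`), twist `T₀^(d_K) = D • W` (rank `1`, `Ш[2^∞] = 0` by `#Sel₂ = 2`), frame point = twist of a rational
point of infinite order, gk2-p3 g27's `natCard_sha_dvd_pow_of_pair_of_frame`, twist transport `Ψ` — except that BOTH relaxed indices are
bounded by the model-free core `relIndex_sha_relaxed_le_prod_natCard_twoTorsion` (`≤ ∏_{q∣d_K} #X(ℚ_q)[2] = ∏ (1 + #roots_q)`, the real condition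
automatic on `Δ < 0`) and the product by §1 (`≤ 2 · 2`).  Unconditional; no Kolyvagin prime, no Q2, no print fact.
[cite: Kramer1981, Thm. 1 and §2 Prop. 3] [cite: GrossLMS1991, §5 (5.1)–(5.3)] [cite: SilvermanAEC2009, X.5 Cor. 5.4, Exercise 10.16, Thm. X.4.2] -/
theorem finite_and_natCard_primaryComponent_sha_baseChange_two_eq_one_of_swappedPair_of_le_succ
    (hΔ : W.Δ < 0) (hIQ : IsImaginaryQuadratic K) (hodd : Odd (NumberField.discr K))
    (hHe : SatisfiesHeegnerHypothesis (W.conductorNorm ℤ) K)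
    (h2K : ∀ P : (W.baseChange K).toAffine.Point, (2 : ℤ) • P = 0 → P = 0)
    (hrk : 1 ≤ W.mordellWeilRank) (hSel : Nat.card (W.selmerGroup 2) = 2)
    {Wd : WeierstrassCurve ℚ} [Wd.IsElliptic] (Cd : VariableChange ℚ) (hWd : Cd • W.quadraticTwist (NumberField.discr K : ℚ) = Wd)
    (hSel1 : Nat.card (Wd.selmerGroup 2) = 1)
    (hDEF : padicValNat 2 Wd.tamagawaProduct ≤ padicValNat 2 W.tamagawaProduct + 1) :
    Finite (AddCommGroup.primaryComponent (↥(W.baseChange K).sha) 2) ∧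
      Nat.card (AddCommGroup.primaryComponent (↥(W.baseChange K).sha) 2) = 1 := by
  haveI : Fact (Nat.Prime 2) := ⟨Nat.prime_two⟩
  haveI : NeZero (2 : ℚ) := ⟨two_ne_zero⟩
  have h2 : Module.finrank ℚ K = 2 := hIQ.1
  have hdK : (NumberField.discr K : ℚ) ≠ 0 := by exact_mod_cast NumberField.discr_ne_zero K
  haveI hT₀ell : (W.quadraticTwist (NumberField.discr K : ℚ)).IsElliptic := W.isElliptic_quadraticTwist hdK
  haveI hX'ell : ((W.quadraticTwist (NumberField.discr K : ℚ)).quadraticTwist (NumberField.discr K : ℚ)).IsElliptic :=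
    (W.quadraticTwist (NumberField.discr K : ℚ)).isElliptic_quadraticTwist hdK
  haveI hT₀Kell : ((W.quadraticTwist (NumberField.discr K : ℚ)).baseChange K).IsElliptic :=
    inferInstanceAs (((W.quadraticTwist (NumberField.discr K : ℚ)).map (algebraMap ℚ K)).IsElliptic)
  -- the one-bit budget in root-count currency
  set P : ℕ := ∏ q ∈ (NumberField.discr K).natAbs.primeFactors,
        ({x : ZMod q | 4 * x ^ 3 + ((integralModelInt W).b₂ : ZMod q) * x ^ 2 +
          2 * ((integralModelInt W).b₄ : ZMod q) * x + ((integralModelInt W).b₆ : ZMod q) = 0}.ncard + 1) with hPdef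
  have hP2 : P ≤ 2 := prod_ncard_roots_add_one_le_two_of_le_succ W hIQ hodd hHe Cd hWd hDEF
  -- `X' = T₀^(d_K) = D • W`, `Aut(K/ℚ) = {1, τ}`, `θ = √d_K`
  obtain ⟨D, hD⟩ := exists_quadraticTwist_quadraticTwist_eq_smul W hdK
  obtain ⟨τ, θ, hτ1, hθQ, hθ2, hτθ, -⟩ := exists_gal_ne_one_sqrt_discr K h2
  -- ### (a) the rank-one member: `rank E(ℚ) = 1`, a rational point of infinite order, `#Sel₂(X') = 2`, `Ш(X'/ℚ)[2^∞] = 0`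
  obtain ⟨hrkW1, -, -⟩ := rank_eq_one_and_sha_primary_eq_zero_of_natCard_selmerGroup_eq_two W hSel hrk
  obtain ⟨Q, hQ⟩ := exists_not_isOfFinAddOrder_of_one_le_mordellWeilRank W hrk
  have hSelX : Nat.card (((W.quadraticTwist (NumberField.discr K : ℚ)).quadraticTwist (NumberField.discr K : ℚ)).selmerGroup 2) = 2 := by
    have h := natCard_selmerGroup_smul W D (n := 2) two_ne_zero
    simp only [Nat.cast_ofNat] at h
    rw [← hD] at h
    exact h.trans hSel
  have hrkX : ((W.quadraticTwist (NumberField.discr K : ℚ)).quadraticTwist (NumberField.discr K : ℚ)).mordellWeilRank = 1 := by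
    have h : (D • W).mordellWeilRank = W.mordellWeilRank := mordellWeilRank_variableChange_holds W D
    rw [← hD] at h
    rw [h, hrkW1]
  obtain ⟨-, -, hT0⟩ := rank_eq_one_and_sha_primary_eq_zero_of_natCard_selmerGroup_eq_two
    ((W.quadraticTwist (NumberField.discr K : ℚ)).quadraticTwist (NumberField.discr K : ℚ)) hSelX (by rw [hrkX])
  -- ### (b) the base `T₀`: `#Sel₂(T₀) = 1`, rank `0`, `Ш(T₀/ℚ)[2^∞] = 0`
  have hSelT : Nat.card ((W.quadraticTwist (NumberField.discr K : ℚ)).selmerGroup ((2 : ℕ) : ℤ)) = 1 := by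
    have h := natCard_selmerGroup_smul (W.quadraticTwist (NumberField.discr K : ℚ)) Cd (n := 2) two_ne_zero
    rw [hWd] at h
    rw [← h, Nat.cast_ofNat]
    exact hSel1
  obtain ⟨hrkT0, -, -⟩ := rank_eq_zero_and_torsionBy_eq_bot_and_sha_inf_torsionBy_eq_bot_of_natCard_selmerGroup_eq_one
    (W.quadraticTwist (NumberField.discr K : ℚ)) 2 hSelT
  have hbotT : AddCommGroup.primaryComponent (↥(W.quadraticTwist (NumberField.discr K : ℚ)).sha) 2 = ⊥ :=
    primaryComponent_sha_eq_bot_of_natCard_selmerGroup_eq_one (W.quadraticTwist (NumberField.discr K : ℚ)) 2 hSelT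
  haveI hfinT : Finite (AddCommGroup.primaryComponent (↥(W.quadraticTwist (NumberField.discr K : ℚ)).sha) 2) := by
    rw [hbotT]; infer_instance
  have hexp : ∀ a ∈ AddCommGroup.primaryComponent (↥(W.quadraticTwist (NumberField.discr K : ℚ)).sha) 2, 2 ^ 0 • a = 0 := by
    intro a ha
    rw [hbotT, AddSubgroup.mem_bot] at ha
    rw [ha, smul_zero]
  have h4 : Nat.card (AddSubgroup.torsionBy (↥(W.quadraticTwist (NumberField.discr K : ℚ)).sha) ((2 : ℕ) : ℤ)) ≤ 4 := by
    have h1 : Nat.card (AddSubgroup.torsionBy (↥(W.quadraticTwist (NumberField.discr K : ℚ)).sha) ((2 : ℕ) : ℤ)) = 1 := by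
      rw [Nat.card_eq_one_iff_unique]
      refine ⟨⟨fun a b ↦ Subtype.ext ?_⟩, ⟨0⟩⟩
      have hmem : ∀ c : AddSubgroup.torsionBy (↥(W.quadraticTwist (NumberField.discr K : ℚ)).sha) ((2 : ℕ) : ℤ),
          (c : ↥(W.quadraticTwist (NumberField.discr K : ℚ)).sha) = 0 := by
        intro c
        have hc : (c : ↥(W.quadraticTwist (NumberField.discr K : ℚ)).sha) ∈
            AddCommGroup.primaryComponent (↥(W.quadraticTwist (NumberField.discr K : ℚ)).sha) 2 :=
          (AddCommGroup.mem_primaryComponent).2 ⟨1, by rw [pow_one, ← natCast_zsmul]; exact mem_torsionBy_iff.mp c.2⟩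
        rwa [hbotT, AddSubgroup.mem_bot] at hc
      rw [hmem a, hmem b]
    omega
  -- ### (c) the frame of `T₀ ⊗ K`: no `2`-torsion, rank `≤ 1`, the anti-invariant point of infinite order
  have hrkTK : ((W.quadraticTwist (NumberField.discr K : ℚ)).baseChange K).mordellWeilRank ≤ 1 := by
    haveI : Module.Finite ℤ ((W.quadraticTwist (NumberField.discr K : ℚ)).baseChange K).toAffine.Point :=
      ((W.quadraticTwist (NumberField.discr K : ℚ)).baseChange K).module_finite_point_holds
    rw [(W.quadraticTwist (NumberField.discr K : ℚ)).mordellWeilRank_baseChange_of_finrank_eq_two_of_finite K h2, hrkT0, hrkX]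
  obtain ⟨C₁, hC₁⟩ := W.exists_variableChange_quadraticTwist_one
  have h2torsT : ∀ P : ((W.quadraticTwist (NumberField.discr K : ℚ)).baseChange K).toAffine.Point, (2 : ℤ) • P = 0 → P = 0 := by
    intro P hP
    let eK : ((W.quadraticTwist (NumberField.discr K : ℚ)).baseChange K).toAffine.Point ≃+ (W.baseChange K).toAffine.Point :=
      ((VariableChange.pointEquiv ((W.quadraticTwist (NumberField.discr K : ℚ)).baseChange K) (twistUntwist hθQ)).trans
        (Affine.Point.congrEquiv (twistUntwist_smul_baseChange W hθQ hθ2))).trans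
        ((Affine.Point.congrEquiv (congrArg (fun V : WeierstrassCurve ℚ ↦ V.baseChange K) hC₁.symm)).trans
          (VariableChange.pointEquivBaseChange W C₁ K).symm)
    have h := h2K (eK P) (by rw [← map_zsmul, hP, map_zero])
    exact eK.injective (h.trans (map_zero eK).symm)
  -- the frame point: the twist of `Q`, anti-invariant of infinite order
  have hτθ' : (τ : K →ₐ[ℚ] K) θ = -θ := hτθ
  obtain ⟨y, hy_inf, hyanti⟩ := exists_antiInvariant_twist_point_of_not_isOfFinAddOrder W hθQ hθ2 hdK hτθ' hQ
  have hanti : IsOfFinAddOrder (Affine.Point.map (W' := W.quadraticTwist (NumberField.discr K : ℚ)) (τ : K →ₐ[ℚ] K) y + y) := by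
    rw [hyanti, neg_add_cancel]
    exact IsOfFinAddOrder.zero
  haveI : Module.Finite ℤ ((W.quadraticTwist (NumberField.discr K : ℚ)).baseChange K).toAffine.Point :=
    ((W.quadraticTwist (NumberField.discr K : ℚ)).baseChange K).module_finite_point_holds
  obtain ⟨M, -, hndiv'⟩ := exists_pow_smul_eq_and_not_of_not_isOfFinAddOrder Nat.prime_two hy_inf
  have hndiv : ∀ Q' : ((W.quadraticTwist (NumberField.discr K : ℚ)).baseChange K).toAffine.Point, ((2 ^ (M + 1) : ℕ) : ℤ) • Q' ≠ y :=
    fun Q' h ↦ hndiv' ⟨Q', h⟩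
  -- ### (d) the two budgets, BOTH by the model-free core, in root-count currency (no parity of `C(W)` needed)
  -- local `2`-torsion counts of `W` at a prime `q ∣ d_K`: `#W(ℚ_q)[2] = 1 + #roots_q`
  have hcountW : ∀ p ∈ (NumberField.discr K).natAbs.primeFactors,
      Nat.card {P : (W.baseChange ((Matsuno2009.primePlace p).adicCompletion ℚ)).toAffine.Point // 2 • P = 0} =
        {x : ZMod p | 4 * x ^ 3 + ((integralModelInt W).b₂ : ZMod p) * x ^ 2 +
          2 * ((integralModelInt W).b₄ : ZMod p) * x + ((integralModelInt W).b₆ : ZMod p) = 0}.ncard + 1 := by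
    intro p hp
    obtain ⟨hpr, hpdvd, -⟩ := Nat.mem_primeFactors.mp hp
    have hpd : (p : ℤ) ∣ NumberField.discr K := Int.natCast_dvd.mpr hpdvd
    have hp2 : p ≠ 2 := by
      rintro rfl
      obtain ⟨r, hr⟩ := hodd
      omega
    haveI := Fact.mk hpr
    rw [natCard_twoTorsion_adicCompletion_eq_padic W (Matsuno2009.primePlace p) (Matsuno2009.natCast_mem_primePlace hpr)]
    exact GenusKolyTwin.natCard_twoTorsion_padic_eq W hp2
      (not_dvd_minimalDiscriminantInt_of_dvd_discr_of_heegner W K hIQ.1 hHe hpr hp2 hpd)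
  have hprodT : ∏ p ∈ (NumberField.discr K).natAbs.primeFactors,
      Nat.card {P : ((W.quadraticTwist (NumberField.discr K : ℚ)).baseChange
        ((Matsuno2009.primePlace p).adicCompletion ℚ)).toAffine.Point // 2 • P = 0} = P := by
    refine Finset.prod_congr rfl fun p hp ↦ ?_
    obtain ⟨hpr, -, -⟩ := Nat.mem_primeFactors.mp hp
    haveI := Fact.mk hpr
    haveI : CharZero ((Matsuno2009.primePlace p).adicCompletion ℚ) :=
      charZero_of_injective_algebraMap (algebraMap ℚ _).injective
    rw [natCard_twoTorsion_baseChange_twin_eq W (W.quadraticTwist (NumberField.discr K : ℚ)) hdK 1 (one_smul _ _)]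
    exact hcountW p hp
  have hprodX : ∏ p ∈ (NumberField.discr K).natAbs.primeFactors,
      Nat.card {P : (((W.quadraticTwist (NumberField.discr K : ℚ)).quadraticTwist (NumberField.discr K : ℚ)).baseChange
        ((Matsuno2009.primePlace p).adicCompletion ℚ)).toAffine.Point // 2 • P = 0} = P := by
    refine Finset.prod_congr rfl fun p hp ↦ ?_
    obtain ⟨hpr, -, -⟩ := Nat.mem_primeFactors.mp hp
    haveI := Fact.mk hpr
    rw [natCard_twoTorsion_baseChange_eq_of_smul D hD ((Matsuno2009.primePlace p).adicCompletion ℚ)]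
    exact hcountW p hp
  -- the base `T₀ = 1 • W^(d_K)`: good at the non-split primes off `d_K`, `Δ(T₀) < 0`
  have hgoodT : ∀ p : ℕ, p.Prime → ¬ (p : ℤ) ∣ NumberField.discr K → ((Ideal.span {(p : ℤ)}).primesOver (𝓞 K)).ncard ≠ 2 →
      (W.quadraticTwist (NumberField.discr K : ℚ)).HasGoodReductionAt (Matsuno2009.primePlace p) :=
    fun _ hp hpd hns ↦ hasGoodReductionAt_primePlace_twin_of_ncard_ne_two W K h2 hodd hHe
      (Wd := W.quadraticTwist (NumberField.discr K : ℚ)) 1 (one_smul _ _) hp hpd hns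
  have hneT := relIndex_sha_relaxed_ne_zero (W.quadraticTwist (NumberField.discr K : ℚ)) K h2 hodd hgoodT
  have hleT := relIndex_sha_relaxed_le_prod_natCard_twoTorsion (W.quadraticTwist (NumberField.discr K : ℚ)) K h2 hodd hgoodT
  have hΔT : (W.quadraticTwist (NumberField.discr K : ℚ)).Δ < 0 := by
    rw [quadraticTwist_Δ]
    have h6 : (0 : ℚ) < (NumberField.discr K : ℚ) ^ 6 := Even.pow_pos (by norm_num) hdK
    exact mul_neg_of_pos_of_neg h6 hΔ
  rw [comap_resBaseChange_sha_inf_iInf_eq_of_Δ_neg _ K hΔT] at hneT hleT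
  rw [hprodT] at hleT
  -- the twist `X' = D • W`: good at the non-split primes off `d_K`, `Δ(X') < 0`
  have hgoodX : ∀ p : ℕ, p.Prime → ¬ (p : ℤ) ∣ NumberField.discr K → ((Ideal.span {(p : ℤ)}).primesOver (𝓞 K)).ncard ≠ 2 →
      ((W.quadraticTwist (NumberField.discr K : ℚ)).quadraticTwist (NumberField.discr K : ℚ)).HasGoodReductionAt (Matsuno2009.primePlace p) := by
    intro p hp _ hns
    rw [hD]
    exact (hasGoodReductionAt_smul_iff_holds (Matsuno2009.primePlace p) W D).mpr
      (hasGoodReductionAt_primePlace_of_ncard_ne_two W K hHe hp hns)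
  have hneX := relIndex_sha_relaxed_ne_zero ((W.quadraticTwist (NumberField.discr K : ℚ)).quadraticTwist (NumberField.discr K : ℚ))
    K h2 hodd hgoodX
  have hleX := relIndex_sha_relaxed_le_prod_natCard_twoTorsion
    ((W.quadraticTwist (NumberField.discr K : ℚ)).quadraticTwist (NumberField.discr K : ℚ)) K h2 hodd hgoodX
  have hΔX : ((W.quadraticTwist (NumberField.discr K : ℚ)).quadraticTwist (NumberField.discr K : ℚ)).Δ < 0 := by
    rw [hD, variableChange_Δ]
    have h1 : (0 : ℚ) < ((D.u⁻¹ : ℚˣ) : ℚ) ^ 12 := Even.pow_pos (by norm_num) (Units.ne_zero _)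
    nlinarith [mul_pos h1 (neg_pos.mpr hΔ)]
  rw [comap_resBaseChange_sha_inf_iInf_eq_of_Δ_neg _ K hΔX] at hneX hleX
  rw [hprodX] at hleX
  have hbud4 :
      ((W.quadraticTwist (NumberField.discr K : ℚ)).sha).relIndex
          ((((W.quadraticTwist (NumberField.discr K : ℚ)).baseChange K).sha).comap
            (resBaseChange (W.quadraticTwist (NumberField.discr K : ℚ)) K)) *
        (((W.quadraticTwist (NumberField.discr K : ℚ)).quadraticTwist (NumberField.discr K : ℚ)).sha).relIndex
          (((((W.quadraticTwist (NumberField.discr K : ℚ)).quadraticTwist (NumberField.discr K : ℚ)).baseChange K).sha).comap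
            (resBaseChange ((W.quadraticTwist (NumberField.discr K : ℚ)).quadraticTwist (NumberField.discr K : ℚ)) K)) ≤ 4 :=
    calc _ ≤ P * P := Nat.mul_le_mul hleT hleX
      _ ≤ 2 * 2 := Nat.mul_le_mul hP2 hP2
  -- ### (e) the sandwich for the base `T₀`: `#Ш(T₀/K)[2^∞] ∣ 4^0`
  obtain ⟨hfinTK, hdvd⟩ := natCard_sha_dvd_pow_of_pair_of_frame (W.quadraticTwist (NumberField.discr K : ℚ)) K hIQ hτ1 h2torsT
    hrkTK y M hndiv hanti hT0 hneT hneX hbud4 hexp h4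
  rw [mul_zero, pow_zero, Nat.dvd_one] at hdvd
  -- ### (f) transport along `Ψ : H¹(K, T₀) ≃ H¹(K, E)`
  haveI := hfinTK
  obtain ⟨Ψ, hΨ, -, -, -⟩ := exists_galH1_twistTransport W K h2 hθQ hθ2 τ hτ1
  obtain ⟨hfin, hcard⟩ := finite_and_natCard_primaryComponent_eq_of_addEquiv Ψ
    (((W.quadraticTwist (NumberField.discr K : ℚ)).baseChange K).sha) ((W.baseChange K).sha) hΨ 2
  exact ⟨hfin, hcard.trans hdvd⟩

/-- **The same, all inputs on the `ℚ`-side** (`E(K)[2] = 0` discharged: `#Sel₂(E) = 2` with `rank E(ℚ) ≥ 1` gives `E(ℚ)[2] = 0`, hence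
`E(K)[2] = 0` by g23's `forall_two_zsmul_baseChange_eq_zero_of_heegner`).  `W/ℚ` globally minimal with `Δ_W < 0` (any `C(W)`); `K` imaginary
quadratic, `d_K` odd, Heegner for `N_W`; `rank E(ℚ) ≥ 1`, `#Sel₂(E) = 2`; `Wd = Cd • W^(d_K)` elliptic with `#Sel₂(Wd) = 1` and
`ord₂ C(Wd) ≤ ord₂ C(W) + 1`.  Then **`#Ш(E/K)[2^∞] = 1`** (finite).  On `C(W)` odd this is g23's `Δ < 0` branch; on the cell
`(Δ < 0, ord₂ C(W) = 1)` that `closes` consumes it is the K-side exactness input of a depth-ONE swapped line.  Unconditional.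
[cite: Kramer1981, Thm. 1 and §2 Prop. 3] [cite: GrossLMS1991, §5 (5.1)–(5.3)] [cite: SilvermanAEC2009, X.5 Cor. 5.4, Thm. X.4.2] -/
theorem natCard_primaryComponent_sha_baseChange_two_eq_one_of_swappedPair_of_le_succ
    (hΔ : W.Δ < 0) (hIQ : IsImaginaryQuadratic K) (hodd : Odd (NumberField.discr K))
    (hHe : SatisfiesHeegnerHypothesis (W.conductorNorm ℤ) K)
    (hrk : 1 ≤ W.mordellWeilRank) (hSel : Nat.card (W.selmerGroup 2) = 2)
    {Wd : WeierstrassCurve ℚ} [Wd.IsElliptic] (Cd : VariableChange ℚ) (hWd : Cd • W.quadraticTwist (NumberField.discr K : ℚ) = Wd)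
    (hSel1 : Nat.card (Wd.selmerGroup 2) = 1)
    (hDEF : padicValNat 2 Wd.tamagawaProduct ≤ padicValNat 2 W.tamagawaProduct + 1) :
    Finite (AddCommGroup.primaryComponent (↥(W.baseChange K).sha) 2) ∧
      Nat.card (AddCommGroup.primaryComponent (↥(W.baseChange K).sha) 2) = 1 := by
  obtain ⟨-, hT2, -⟩ := rank_eq_one_and_sha_primary_eq_zero_of_natCard_selmerGroup_eq_two W hSel hrk
  exact finite_and_natCard_primaryComponent_sha_baseChange_two_eq_one_of_swappedPair_of_le_succ W K hΔ hIQ hodd hHe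
    (forall_two_zsmul_baseChange_eq_zero_of_heegner W K hIQ hodd hHe (fun P hP ↦ by convert hT2 P (by convert hP)))
    hrk hSel Cd hWd hSel1 hDEF

end Swapped

end Summit.BirchSwinnertonDyer.BirchSwinnertonDyer.Theorems.GenusExact.TwinSwap.OneBit

end
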